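import Summits.QuantumFields.YangMills.Theorems.BalabanUVNodesN15TwoSpacingGluingCurvedKnitReg335
import Summits.QuantumFields.YangMills.Theorems.BalabanUVNodesN15TwoSpacingGluingCurvedKnitDefectReg335
import HarnessLib

/-!
# THE GLUING STEP AT TWO LATTICE SPACINGS — (Γ15) THE LIVE-`U` KNIT AT THE COVER, X: THE ONE-STEP NEIGHBOURHOOD OF THE CUT BOX IS A BOX — the interior condition of FILES 125∕126
# DISCHARGED for the canonical sets `Q_k = {x | B(x) ∈ c(2w+1, k) + [0, 6w+3)^{d+1}}`, and FILES 125 ∕ 126 read with the class (3.35) ON THOSE BOXES (dag-n15-c g15, FILE 127; N15 = NE2, s1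
# «background-layer OPERATOR ingredient»)

Cell `pub-ymgap`, seat `pub-ymgap-dag-n15-c` (R134 (a); HUMAN RULING D-0062), generation 15.  `bears_on: R4∕N15 · K3⁸ SpineGivenEndpointR13SepCoPHV (stmt-QuantumFields-27366)`.
Filed `--kind proof --supports stmt-QuantumFields-27366 --as helper` — COUNT-NEUTRAL.  Theorems only; 0 `def`, 0 `sorry`.  Imports BY NAME FILES 125 `…CurvedKnitReg335` ∕ 126 `…CurvedKnitDefectReg335` (through them FILES 120 ∕ 123, FILE 117's
nested boxes `mem_cubeBlocks_of_mem_inner` ∕ `sub_coverCorner_eq_add`, dag-n15-a `chiCube_of_not_mem`, dag-n15-b `blockOf_add_unitVec` ∕ `blockOf_sub_unitVec`).  Nothing in the tree is modified.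

* §1 `add_unitVec_mem_cubeBlocks_of_mem` ∕ `sub_unitVec_mem_cubeBlocks_of_mem` — a unit step of a block of the box `c(m₁,k) + [0,S₁)^{d+1}` stays in the box `c(m₀,k) + [0,S₀)^{d+1}` one block
  larger on every side (`m₁ + 1 ≤ m₀`, `(m₀ − m₁) + S₁ + 1 ≤ S₀ ≤ 2qw`); `blockOf_shift_mem_cubeBlocks` — hence the blocks of `x ± e′_μ` (fine steps: same block or a unit step, dag-n15-b).
* §2 ★ `cvChi_ne_zero_nbhd` — for the cover's cut `χ_k` (box `c(2w,k) + [0,6w+1)`): `χ_k(x) ≠ 0 ⟹ x, τ_μx, τ_μ⁻¹x ∈ Q_k := {x | B(x) ∈ c(2w+1,k) + [0,6w+3)}` — FILE 125's displayed `hQ`.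
* §3 ★★★ `uN_cvGlued_spec_of_reg335Box` ∕ §4 ★★★ `uN_idef_cvGlued_of_reg335Box` — FILES 125 ∕ 126 with `Q_k` (and `Q′_k`) THE BOXES and `hQ` (`hQ′`) discharged: the live-`U` knit (decay + two-sided inverse) for every `U(m)` bond field in Bałaban's class (3.35)
  `Reg335Cube τ U L^{−k} Q_k ξ C` on the box `Q_k` around each cut box — the reading «(3.35) holds on □̃ ⊃ □» of [B9] Thm 3.1.

HONEST FRAMING ∕ LIMITS.  `ZMod.val` bookkeeping + one application; the class (3.35) per box is the HYPOTHESIS; MODEL carriers; the SHAPE of [B9] Thm 3.1, not the printed theorem; nothing of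
[B5]∕[B6]∕[B9] asserted.  NE2⁺ NOT PRINTED, NOT proved; N15 NOT discharged; K3⁸ OPEN, skeleton v6 untouched; counts of record UNMOVED (typed 28∕28 · discharged 5∕27); one finite 𝕋⁴ at fixed ε —
NOT infinite volume, NOT OS on ℝ⁴, NOT a mass gap, NOT Clay; R4 closes the conditional finite-𝕋⁴ rung `BalabanLadder.UV` only.  Restate-immune.
-/

noncomputable section

open scoped BigOperators Matrix Matrix.Norms.L2Operator

namespace Summit.QuantumFields.YangMills.BalabanUVNodes.N15.Gluing

open Real
open Literature.MathematicalPhysics.QuantumFieldTheory.Balaban1983to89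
open Literature.MathematicalPhysics.QuantumFieldTheory.Balaban1983to89.B5Prop11Plancherel (Tor fine unitVec)
open Literature.MathematicalPhysics.QuantumFieldTheory.Balaban1983to89.B11SectG (BlockNorm HasMaj)
open Literature.MathematicalPhysics.QuantumFieldTheory.Balaban1983to89.B6Prop26Gluing (mulOp)
open Literature.MathematicalPhysics.QuantumFieldTheory.Balaban1983to89.B6UnitTorusCarrier (unitTorusGeo)
open Literature.MathematicalPhysics.QuantumFieldTheory.Balaban1983to89.B9Eq335RegularityClasses (Reg335Cube)
open Literature.MathematicalPhysics.QuantumFieldTheory.King1986.Torus (blockOf tdistT)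
open Literature.Barriers.QuantumFields (traceForm)
open Summit.QuantumFields.YangMills.BalabanUVNodes.N15.BackgroundLayer (covLapM tCoefA tCoefC)
open Summit.QuantumFields.YangMills.BalabanUVNodes.N15.VectorPiece (bshiftEquiv bshiftEquiv_apply bshiftEquiv_symm_apply blockOf_add_unitVec blockOf_sub_unitVec kingPrV)
open Summit.QuantumFields.YangMills.BalabanUVNodes.N15.MatrixSpecies (mmulOp coordMat basisConst liftBlk liftMap)
open Literature.MathematicalPhysics.QuantumFieldTheory.Balaban1983to89.T4EtaRateDefect (idef)
open Literature.MathematicalPhysics.QuantumFieldTheory.Balaban1983to89.T4EtaRateCoeffDefect (pull)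
open Summit.QuantumFields.YangMills.BalabanUVNodes.N15.TwoGrid (chiCube cubeBlocks mem_cubeBlocks chiCube_of_not_mem)
open Summit.QuantumFields.YangMills.BalabanUVNodes.N15.CurvedSpecies (gaugePair)

variable {d : ℕ}

/-! ## §1 A unit step of a block of a box stays in the box one block larger -/

section Step

variable {M : Fin (d + 1) → ℕ} [∀ μ, NeZero (M μ)] {n w q m₀ m₁ S₀ S₁ : ℕ} [NeZero n]

/-- `y ∈ c(m₁,k) + [0,S₁) ⟹ y + e_κ ∈ c(m₀,k) + [0,S₀)` for `m₁ ≤ m₀`, `(m₀ − m₁) + S₁ + 1 ≤ S₀ ≤ 2qw`. [folklore] -/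
theorem add_unitVec_mem_cubeBlocks_of_mem (hM : ∀ ν, M ν = 2 * q * w) (hm : m₁ ≤ m₀) (hfit : (m₀ - m₁) + S₁ + 1 ≤ S₀) (hS₀ : S₀ ≤ 2 * q * w) {k : Fin (d + 1) → ZMod (2 * q)}
    {y : Tor M} (hy : y ∈ cubeBlocks M (coverCorner M w q m₁ k) S₁) (κ : Fin (d + 1)) : y + unitVec M κ ∈ cubeBlocks M (coverCorner M w q m₀ k) S₀ := by
  rw [mem_cubeBlocks] at hy ⊢
  intro ν
  have h1 : ((y - coverCorner M w q m₁ k) ν).val < S₁ := hy ν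
  have hb : ((m₀ - m₁ : ℕ) : ZMod (M ν)).val = m₀ - m₁ := ZMod.val_natCast_of_lt (by rw [hM ν]; omega)
  have e1 : (y + unitVec M κ - coverCorner M w q m₀ k) ν = (y - coverCorner M w q m₁ k) ν + ((m₀ - m₁ : ℕ) : ZMod (M ν)) + unitVec M κ ν := by
    have := sub_coverCorner_eq_add (M := M) (w := w) (q := q) hm k y ν
    simp only [Pi.sub_apply, Pi.add_apply] at this ⊢
    rw [← this]; ring
  show ((y + unitVec M κ - coverCorner M w q m₀ k) ν).val < S₀
  rw [e1]
  by_cases hκ : ν = κ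
  · subst hκ
    have hu : (unitVec M ν ν : ZMod (M ν)) = ((1 : ℕ) : ZMod (M ν)) := by simp [unitVec]
    have h1v : ((1 : ℕ) : ZMod (M ν)).val = 1 := ZMod.val_natCast_of_lt (by rw [hM ν]; omega)
    rw [hu, ZMod.val_add, ZMod.val_add, hb]
    calc ((((y - coverCorner M w q m₁ k) ν).val + (m₀ - m₁)) % M ν + ((1 : ℕ) : ZMod (M ν)).val) % M ν
        ≤ (((y - coverCorner M w q m₁ k) ν).val + (m₀ - m₁)) % M ν + ((1 : ℕ) : ZMod (M ν)).val := Nat.mod_le _ _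
      _ ≤ ((y - coverCorner M w q m₁ k) ν).val + (m₀ - m₁) + 1 := by rw [h1v]; exact Nat.add_le_add_right (Nat.mod_le _ _) 1
      _ < S₀ := by omega
  · have hu : (unitVec M κ ν : ZMod (M ν)) = 0 := by simp [unitVec, hκ]
    rw [hu, add_zero, ZMod.val_add, hb]
    exact (Nat.mod_le _ _).trans_lt (by omega)

/-- `y ∈ c(m₁,k) + [0,S₁) ⟹ y − e_κ ∈ c(m₀,k) + [0,S₀)` for `m₁ + 1 ≤ m₀`, `(m₀ − m₁) + S₁ ≤ S₀ ≤ 2qw`. [folklore] -/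
theorem sub_unitVec_mem_cubeBlocks_of_mem (hM : ∀ ν, M ν = 2 * q * w) (hm : m₁ + 1 ≤ m₀) (hfit : (m₀ - m₁) + S₁ ≤ S₀) (hS₀ : S₀ ≤ 2 * q * w) {k : Fin (d + 1) → ZMod (2 * q)}
    {y : Tor M} (hy : y ∈ cubeBlocks M (coverCorner M w q m₁ k) S₁) (κ : Fin (d + 1)) : y - unitVec M κ ∈ cubeBlocks M (coverCorner M w q m₀ k) S₀ := by
  rw [mem_cubeBlocks] at hy ⊢
  intro ν
  have h1 : ((y - coverCorner M w q m₁ k) ν).val < S₁ := hy ν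
  show ((y - unitVec M κ - coverCorner M w q m₀ k) ν).val < S₀
  by_cases hκ : ν = κ
  · subst hκ
    have hb : ((m₀ - m₁ - 1 : ℕ) : ZMod (M ν)).val = m₀ - m₁ - 1 := ZMod.val_natCast_of_lt (by rw [hM ν]; omega)
    have hu : (unitVec M ν ν : ZMod (M ν)) = ((1 : ℕ) : ZMod (M ν)) := by simp [unitVec]
    have e1 : (y - unitVec M ν - coverCorner M w q m₀ k) ν = (y - coverCorner M w q m₁ k) ν + ((m₀ - m₁ - 1 : ℕ) : ZMod (M ν)) := by
      have := sub_coverCorner_eq_add (M := M) (w := w) (q := q) (show m₁ ≤ m₀ by omega) k y ν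
      simp only [Pi.sub_apply] at this ⊢
      rw [hu, Nat.cast_sub (show 1 ≤ m₀ - m₁ by omega), Nat.cast_one, sub_right_comm, this]
      ring
    rw [e1, ZMod.val_add, hb]
    exact (Nat.mod_le _ _).trans_lt (by omega)
  · have hb : ((m₀ - m₁ : ℕ) : ZMod (M ν)).val = m₀ - m₁ := ZMod.val_natCast_of_lt (by rw [hM ν]; omega)
    have hu : (unitVec M κ ν : ZMod (M ν)) = 0 := by simp [unitVec, hκ]
    have e1 : (y - unitVec M κ - coverCorner M w q m₀ k) ν = (y - coverCorner M w q m₁ k) ν + ((m₀ - m₁ : ℕ) : ZMod (M ν)) := by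
      have := sub_coverCorner_eq_add (M := M) (w := w) (q := q) (show m₁ ≤ m₀ by omega) k y ν
      simp only [Pi.sub_apply] at this ⊢
      rw [hu, sub_zero]; exact this
    rw [e1, ZMod.val_add, hb]
    exact (Nat.mod_le _ _).trans_lt (by omega)

/-- the blocks of `x`, `x + e′_κ`, `x − e′_κ` (fine steps) all lie in the box one block larger than a box containing `B(x)` (dag-n15-b `blockOf_add_unitVec` ∕ `blockOf_sub_unitVec`). [folklore] -/
theorem blockOf_shift_mem_cubeBlocks (hM : ∀ ν, M ν = 2 * q * w) (hm : m₁ + 1 ≤ m₀) (hfit : (m₀ - m₁) + S₁ + 1 ≤ S₀) (hS₀ : S₀ ≤ 2 * q * w) {k : Fin (d + 1) → ZMod (2 * q)}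
    {x : Tor (fine n M)} (hx : blockOf n M x ∈ cubeBlocks M (coverCorner M w q m₁ k) S₁) (κ : Fin (d + 1)) :
    blockOf n M x ∈ cubeBlocks M (coverCorner M w q m₀ k) S₀ ∧ blockOf n M (x + unitVec (fine n M) κ) ∈ cubeBlocks M (coverCorner M w q m₀ k) S₀ ∧
      blockOf n M (x - unitVec (fine n M) κ) ∈ cubeBlocks M (coverCorner M w q m₀ k) S₀ := by
  refine ⟨mem_cubeBlocks_of_mem_inner hM (by omega) (by omega) hS₀ hx, ?_, ?_⟩
  · rw [blockOf_add_unitVec]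
    split_ifs
    · exact add_unitVec_mem_cubeBlocks_of_mem hM (by omega) hfit hS₀ hx κ
    · exact mem_cubeBlocks_of_mem_inner hM (by omega) (by omega) hS₀ hx
  · rcases blockOf_sub_unitVec n M x κ with h | h
    · rw [h]; exact mem_cubeBlocks_of_mem_inner hM (by omega) (by omega) hS₀ hx
    · rw [h]; exact sub_unitVec_mem_cubeBlocks_of_mem hM hm (by omega) hS₀ hx κ

end Step

/-! ## §2 The one-step neighbourhood of the cover's cut box -/

section Nbhd

variable {L : ℕ} [NeZero L]

omit [NeZero L] in
/-- ★ **FILES 125∕126's `hQ` FOR THE BOX `Q_k = {x | B(x) ∈ c(2w+1,k) + [0,6w+3)}`, ANY SPACING `n`**: the cover's cut `χ_k` (box `c(2w,k) + [0,6w+1)`, `w = L^m`, `L ≥ 7`) is supported, with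
its one-step fine neighbourhood, in `Q_k`. [cite: Balaban1985BackgroundPropagators, (3.62)–(3.65) pp.402–403 (nested boxes: shape)] -/
theorem chiCube_cut_ne_zero_nbhd (hL : Odd L ∧ 1 < L) (hL7 : 7 ≤ L) (mv kk n : ℕ) [NeZero n] (k : Fin (d + 1) → ZMod (2 * L)) (x : Tor (fine n (cvM d L mv kk hL)) × Fin (d + 1))
    (hx : chiCube (cvM d L mv kk hL) n (coverCorner (cvM d L mv kk hL) (L ^ mv) L (2 * L ^ mv) k) (6 * L ^ mv + 1) x ≠ 0) :
    x ∈ {x : Tor (fine n (cvM d L mv kk hL)) × Fin (d + 1) | blockOf n (cvM d L mv kk hL) x.1 ∈ cubeBlocks (cvM d L mv kk hL) (coverCorner (cvM d L mv kk hL) (L ^ mv) L (2 * L ^ mv + 1) k) (6 * L ^ mv + 3)} ∧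
      (∀ μ, bshiftEquiv (cvM d L mv kk hL) n μ x ∈ {x : Tor (fine n (cvM d L mv kk hL)) × Fin (d + 1) | blockOf n (cvM d L mv kk hL) x.1 ∈ cubeBlocks (cvM d L mv kk hL) (coverCorner (cvM d L mv kk hL) (L ^ mv) L (2 * L ^ mv + 1) k) (6 * L ^ mv + 3)}) ∧
      (∀ μ, (bshiftEquiv (cvM d L mv kk hL) n μ).symm x ∈ {x : Tor (fine n (cvM d L mv kk hL)) × Fin (d + 1) | blockOf n (cvM d L mv kk hL) x.1 ∈ cubeBlocks (cvM d L mv kk hL) (coverCorner (cvM d L mv kk hL) (L ^ mv) L (2 * L ^ mv + 1) k) (6 * L ^ mv + 3)}) := by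
  have hM : ∀ ν, cvM d L mv kk hL ν = 2 * L * L ^ mv := MP_succ_eq L mv kk hL
  have hS : 6 * L ^ mv + 3 ≤ 2 * L * L ^ mv := by
    have h7 : 7 * L ^ mv ≤ L * L ^ mv := Nat.mul_le_mul_right _ hL7
    have hw : 1 ≤ L ^ mv := Nat.one_le_pow _ _ (by omega)
    have e : 2 * L * L ^ mv = 2 * (L * L ^ mv) := by ring
    rw [e]; omega
  have hin : blockOf n (cvM d L mv kk hL) x.1 ∈ cubeBlocks (cvM d L mv kk hL) (coverCorner (cvM d L mv kk hL) (L ^ mv) L (2 * L ^ mv) k) (6 * L ^ mv + 1) := by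
    by_contra h; exact hx (chiCube_of_not_mem h)
  have key := fun μ => blockOf_shift_mem_cubeBlocks (m₀ := 2 * L ^ mv + 1) (S₀ := 6 * L ^ mv + 3) hM (by omega) (by omega) hS hin μ
  refine ⟨(key 0).1, fun μ => ?_, fun μ => ?_⟩
  · simp only [Set.mem_setOf_eq, bshiftEquiv_apply]; exact (key μ).2.1
  · simp only [Set.mem_setOf_eq, bshiftEquiv_symm_apply]; exact (key μ).2.2

end Nbhd

/-! ## §3 FILE 125 read with the class on the box around each cut box -/

section Box

variable {L : ℕ} [NeZero L]

/-- ★★★ **THE LIVE-`U` KNIT AT THE COVER FOR A BACKGROUND IN BAŁABAN's CLASS (3.35) ON THE BOX `Q_k = {x | B(x) ∈ c(2w+1,k) + [0,6w+3)}` AROUND EACH CUT BOX** — FILE 125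
`uN_cvGlued_spec_of_reg335Cube` with the canonical boxes and its interior hypothesis `hQ` discharged by §2: for every `U(m)` bond field in the class on these boxes there are per-cube gauges,
unitary everywhere, for which the glued operator of `Δ_{R_U} + P` decays and is the two-sided inverse (P's conjugation law and N_V's letters displayed).  MODEL carriers; the SHAPE of [B9] Thm 3.1
(«(3.35) on □̃»), not the printed theorem. [cite: Balaban1985BackgroundPropagators, Thm 3.1 p.397, (3.34)–(3.35) p.396, Cor. 3.6 p.408, (3.62)–(3.65) pp.402–403; Balaban1984PropagatorsII, (2.91)–(2.93) p.239] -/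
theorem uN_cvGlued_spec_of_reg335Box (hL : Odd L ∧ 1 < L) (hL7 : 7 ≤ L) {a : ℝ} (ha : 0 < a) (ι : Type) [Fintype ι] [DecidableEq ι] :
    ∃ δ w₀ R₀ θ₀ B : ℝ, 0 < δ ∧ 0 < R₀ ∧ 0 < θ₀ ∧ 0 < B ∧
      ∀ (mv kk : ℕ), 1 ≤ kk → w₀ ≤ ((L ^ mv : ℕ) : ℝ) →
      ∀ {mm : Type} [Fintype mm] [DecidableEq mm] [Nonempty mm] (e : Matrix mm mm ℂ ≃L[ℝ] (ι → ℝ)), (∀ A B : Matrix mm mm ℂ, traceForm A B = e A ⬝ᵥ e B) →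
      ∀ (U : Fin (d + 1) → CvX d L mv kk hL → (Matrix mm mm ℂ)ˣ), (∀ μ x, (U μ x : Matrix mm mm ℂ) ∈ Matrix.unitaryGroup mm ℂ) →
      ∀ (ξ C : ℝ), 0 < ξ → 0 ≤ C →
        (∀ k, Reg335Cube (bshiftEquiv (cvM d L mv kk hL) (L ^ kk)) U ((((L ^ kk : ℕ) : ℝ))⁻¹)
          {x : CvX d L mv kk hL | blockOf (L ^ kk) (cvM d L mv kk hL) x.1 ∈ cubeBlocks (cvM d L mv kk hL) (coverCorner (cvM d L mv kk hL) (L ^ mv) L (2 * L ^ mv + 1) k) (6 * L ^ mv + 3)} ξ C) →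
      ∀ (rV RN θF : ℝ), 0 ≤ rV → 0 ≤ RN → 0 ≤ θF →
        Fintype.card ι * (@basisConst ι _ (Matrix mm mm ℂ) Matrix.frobeniusNormedAddCommGroup Matrix.frobeniusNormedSpace e * (2 * Real.sqrt (Fintype.card mm)) * (Real.sqrt (Fintype.card mm) * ((C / ξ) * Real.exp (((((L ^ kk : ℕ) : ℝ))⁻¹) * (C / ξ))))) ≤ rV →
        Fintype.card ι * (Fintype.card (Fin (d + 1)) * (Fintype.card ι * (@basisConst ι _ (Matrix mm mm ℂ) Matrix.frobeniusNormedAddCommGroup Matrix.frobeniusNormedSpace e * (2 * Real.sqrt (Fintype.card mm)) * (Real.sqrt (Fintype.card mm) * ((C / ξ) * Real.exp (((((L ^ kk : ℕ) : ℝ))⁻¹) * (C / ξ))))) ^ 2 + @basisConst ι _ (Matrix mm mm ℂ) Matrix.frobeniusNormedAddCommGroup Matrix.frobeniusNormedSpace e * (2 * Real.sqrt (Fintype.card mm)) * (Real.sqrt (Fintype.card mm) * ((C / ξ ^ 2) * Real.exp (((((L ^ kk : ℕ) : ℝ))⁻¹) * (C / ξ)))))) ≤ rV →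
        rV * (1 + Fintype.card (Fin (d + 1) ⊕ Fin (d + 1))) + RN ≤ R₀ → θF ≤ θ₀ →
      ∃ w : (Fin (d + 1) → ZMod (2 * L)) → CvX d L mv kk hL → Matrix mm mm ℂ, (∀ k x, (w k x)ᴴ * w k x = 1) ∧
        ∀ (P : (CvX d L mv kk hL × ι → ℝ) →ₗ[ℝ] (CvX d L mv kk hL × ι → ℝ)) (NV : (Fin (d + 1) → ZMod (2 * L)) → (CvX d L mv kk hL × ι → ℝ) →ₗ[ℝ] (CvX d L mv kk hL × ι → ℝ)),
        (∀ k, mmulOp (fun x => coordMat e (ContinuousLinearMap.mulLeftRight ℝ (Matrix mm mm ℂ) (w k x) (w k x)ᴴ)) ∘ₗ P ∘ₗ mmulOp (fun x => (coordMat e (ContinuousLinearMap.mulLeftRight ℝ (Matrix mm mm ℂ) (w k x) (w k x)ᴴ))ᵀ) = (cvNL d L mv kk hL a ι) - NV k) →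
        (∀ k, HasMaj (CvNorm d L mv kk hL ι) (CvNorm d L mv kk hL ι) (mulOp (fun p : CvX d L mv kk hL × ι => cvPsi d L mv kk hL k p.1) ∘ₗ NV k ∘ₗ mulOp (fun p : CvX d L mv kk hL × ι => cvChi d L mv kk hL k p.1)) (fun y y' => RN * Real.exp (-(δ * (unitTorusGeo L kk (cvM d L mv kk hL)).dist y y')))) →
        (∀ k, HasMaj (CvNorm d L mv kk hL ι) (CvNorm d L mv kk hL ι) ((LinearMap.id - mulOp (fun p : CvX d L mv kk hL × ι => cvPsi d L mv kk hL k p.1)) ∘ₗ NV k ∘ₗ mulOp (fun p : CvX d L mv kk hL × ι => cvChi d L mv kk hL k p.1)) (fun y y' => θF * Real.exp (-(δ * (unitTorusGeo L kk (cvM d L mv kk hL)).dist y y')))) →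
                HasMaj (CvNorm d L mv kk hL ι) (CvNorm d L mv kk hL ι) (cvGlued d L mv kk hL a ((((L ^ kk : ℕ) : ℝ))⁻¹) ι e w (fun μ x => (U μ x : Matrix mm mm ℂ)) P NV)
          (fun y y' => B * Real.exp (-(δ / 16 * (unitTorusGeo L kk (cvM d L mv kk hL)).dist y y'))) ∧
        (cvGlued d L mv kk hL a ((((L ^ kk : ℕ) : ℝ))⁻¹) ι e w (fun μ x => (U μ x : Matrix mm mm ℂ)) P NV ∘ₗ (covLapM (bshiftEquiv (cvM d L mv kk hL) (L ^ kk)) ((((L ^ kk : ℕ) : ℝ))⁻¹) (gaugePair (bshiftEquiv (cvM d L mv kk hL) (L ^ kk)) (fun μ x => coordMat e (ContinuousLinearMap.mulLeftRight ℝ (Matrix mm mm ℂ) (U μ x : Matrix mm mm ℂ) (U μ x : Matrix mm mm ℂ)ᴴ))) + P) = LinearMap.id ∧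
          (covLapM (bshiftEquiv (cvM d L mv kk hL) (L ^ kk)) ((((L ^ kk : ℕ) : ℝ))⁻¹) (gaugePair (bshiftEquiv (cvM d L mv kk hL) (L ^ kk)) (fun μ x => coordMat e (ContinuousLinearMap.mulLeftRight ℝ (Matrix mm mm ℂ) (U μ x : Matrix mm mm ℂ) (U μ x : Matrix mm mm ℂ)ᴴ))) + P) ∘ₗ cvGlued d L mv kk hL a ((((L ^ kk : ℕ) : ℝ))⁻¹) ι e w (fun μ x => (U μ x : Matrix mm mm ℂ)) P NV = LinearMap.id) := by
  obtain ⟨δ, w₀, R₀, θ₀, B, hδ, hR₀, hθ₀, hB, H⟩ := uN_cvGlued_spec_of_reg335Cube (d := d) hL hL7 ha ι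
  refine ⟨δ, w₀, R₀, θ₀, B, hδ, hR₀, hθ₀, hB, fun mv kk hk hw₀ => ?_⟩
  intro mm _ _ _ e he U hU ξ C hξ hC h335
  exact H mv kk hk hw₀ e he U hU (fun k => {x : CvX d L mv kk hL | blockOf (L ^ kk) (cvM d L mv kk hL) x.1 ∈ cubeBlocks (cvM d L mv kk hL) (coverCorner (cvM d L mv kk hL) (L ^ mv) L (2 * L ^ mv + 1) k) (6 * L ^ mv + 3)}) ξ C hξ hC h335 (fun k x hx => chiCube_cut_ne_zero_nbhd hL hL7 mv kk (L ^ kk) k x hx)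

end Box

/-! ## §4 FILE 126 read with the class on the boxes around each cut box, both grids -/

section BoxTwoGrid

variable {L : ℕ} [NeZero L]

/-- ★★★ **THE η-DEFECT OF THE LIVE-`U` KNIT FOR BACKGROUNDS IN BAŁABAN's CLASS (3.35) ON THE BOXES AROUND THE CUT BOXES, BOTH GRIDS** — FILE 126 `uN_idef_cvGlued_of_reg335Cube` with the
canonical boxes `{x | B(x) ∈ c(2w+1,k) + [0,6w+3)}` (coarse blocks `B = blockOf L^k`, fine blocks `B = blockOf (L^rL^k)`) and both interior hypotheses discharged by §2.  MODEL carriers; the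
SHAPE of [B9] Thm 3.14, not the printed theorem. [cite: Balaban1985BackgroundPropagators, Thm 3.14 pp.426–427 (template), (3.34)–(3.35) p.396, Cor. 3.6 p.408; Balaban1984PropagatorsII, (2.133)–(2.136) p.247] -/
theorem uN_idef_cvGlued_of_reg335Box (hL : Odd L ∧ 1 < L) (hL7 : 7 ≤ L) {a : ℝ} (ha : 0 < a) (ι : Type) [Fintype ι] [DecidableEq ι] :
    ∃ δ w₀ R₀ θ₀ D : ℝ, 0 < δ ∧ 0 < R₀ ∧ 0 < θ₀ ∧
      ∀ (mv kk r : ℕ), 1 ≤ kk → w₀ ≤ ((L ^ mv : ℕ) : ℝ) →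
      ∀ {mm : Type} [Fintype mm] [DecidableEq mm] [Nonempty mm] (e : Matrix mm mm ℂ ≃L[ℝ] (ι → ℝ)), (∀ A B : Matrix mm mm ℂ, traceForm A B = e A ⬝ᵥ e B) →
      ∀ (U : Fin (d + 1) → CvX d L mv kk hL → (Matrix mm mm ℂ)ˣ) (U' : Fin (d + 1) → CvX' d L mv kk r hL → (Matrix mm mm ℂ)ˣ),
        (∀ μ x, (U μ x : Matrix mm mm ℂ) ∈ Matrix.unitaryGroup mm ℂ) → (∀ μ x', (U' μ x' : Matrix mm mm ℂ) ∈ Matrix.unitaryGroup mm ℂ) →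
      ∀ (ξ C ξ' C' : ℝ), 0 < ξ → 0 ≤ C → 0 < ξ' → 0 ≤ C' →
        (∀ k, Reg335Cube (bshiftEquiv (cvM d L mv kk hL) (L ^ kk)) U ((((L ^ kk : ℕ) : ℝ))⁻¹)
          {x : CvX d L mv kk hL | blockOf (L ^ kk) (cvM d L mv kk hL) x.1 ∈ cubeBlocks (cvM d L mv kk hL) (coverCorner (cvM d L mv kk hL) (L ^ mv) L (2 * L ^ mv + 1) k) (6 * L ^ mv + 3)} ξ C) →
        (∀ k, Reg335Cube (bshiftEquiv (cvM d L mv kk hL) (L ^ r * L ^ kk)) U' ((((L ^ r * L ^ kk : ℕ) : ℝ))⁻¹)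
          {x : CvX' d L mv kk r hL | blockOf (L ^ r * L ^ kk) (cvM d L mv kk hL) x.1 ∈ cubeBlocks (cvM d L mv kk hL) (coverCorner (cvM d L mv kk hL) (L ^ mv) L (2 * L ^ mv + 1) k) (6 * L ^ mv + 3)} ξ' C') →
      ∀ (rV RN rD oV oN o oW : ℝ), 0 ≤ rV → 0 ≤ RN → 0 ≤ rD → 0 ≤ oV → 0 ≤ oN → 0 ≤ oW →
        Fintype.card ι * (@basisConst ι _ (Matrix mm mm ℂ) Matrix.frobeniusNormedAddCommGroup Matrix.frobeniusNormedSpace e * (2 * Real.sqrt (Fintype.card mm)) * (Real.sqrt (Fintype.card mm) * ((C / ξ) * Real.exp (((((L ^ kk : ℕ) : ℝ))⁻¹) * (C / ξ))))) ≤ rV →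
        Fintype.card ι * (Fintype.card (Fin (d + 1)) * (Fintype.card ι * (@basisConst ι _ (Matrix mm mm ℂ) Matrix.frobeniusNormedAddCommGroup Matrix.frobeniusNormedSpace e * (2 * Real.sqrt (Fintype.card mm)) * (Real.sqrt (Fintype.card mm) * ((C / ξ) * Real.exp (((((L ^ kk : ℕ) : ℝ))⁻¹) * (C / ξ))))) ^ 2 + @basisConst ι _ (Matrix mm mm ℂ) Matrix.frobeniusNormedAddCommGroup Matrix.frobeniusNormedSpace e * (2 * Real.sqrt (Fintype.card mm)) * (Real.sqrt (Fintype.card mm) * ((C / ξ ^ 2) * Real.exp (((((L ^ kk : ℕ) : ℝ))⁻¹) * (C / ξ)))))) ≤ rV →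
        Fintype.card ι * (@basisConst ι _ (Matrix mm mm ℂ) Matrix.frobeniusNormedAddCommGroup Matrix.frobeniusNormedSpace e * (2 * Real.sqrt (Fintype.card mm)) * (Real.sqrt (Fintype.card mm) * ((C' / ξ') * Real.exp (((((L ^ r * L ^ kk : ℕ) : ℝ))⁻¹) * (C' / ξ'))))) ≤ rV →
        Fintype.card ι * (Fintype.card (Fin (d + 1)) * (Fintype.card ι * (@basisConst ι _ (Matrix mm mm ℂ) Matrix.frobeniusNormedAddCommGroup Matrix.frobeniusNormedSpace e * (2 * Real.sqrt (Fintype.card mm)) * (Real.sqrt (Fintype.card mm) * ((C' / ξ') * Real.exp (((((L ^ r * L ^ kk : ℕ) : ℝ))⁻¹) * (C' / ξ'))))) ^ 2 + @basisConst ι _ (Matrix mm mm ℂ) Matrix.frobeniusNormedAddCommGroup Matrix.frobeniusNormedSpace e * (2 * Real.sqrt (Fintype.card mm)) * (Real.sqrt (Fintype.card mm) * ((C' / ξ' ^ 2) * Real.exp (((((L ^ r * L ^ kk : ℕ) : ℝ))⁻¹) * (C' / ξ')))))) ≤ rV →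
        rV * (1 + Fintype.card (Fin (d + 1) ⊕ Fin (d + 1))) + RN ≤ R₀ → oV * (1 + Fintype.card (Fin (d + 1) ⊕ Fin (d + 1))) + oN ≤ o →
      ∀ (θF : ℝ), θF ≤ θ₀ →
      ∃ (w : (Fin (d + 1) → ZMod (2 * L)) → CvX d L mv kk hL → Matrix mm mm ℂ) (w' : (Fin (d + 1) → ZMod (2 * L)) → CvX' d L mv kk r hL → Matrix mm mm ℂ),
        (∀ k x, (w k x)ᴴ * w k x = 1) ∧ (∀ k x', (w' k x')ᴴ * w' k x' = 1) ∧
        ∀ (P : (CvX d L mv kk hL × ι → ℝ) →ₗ[ℝ] (CvX d L mv kk hL × ι → ℝ)) (P' : (CvX' d L mv kk r hL × ι → ℝ) →ₗ[ℝ] (CvX' d L mv kk r hL × ι → ℝ))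
          (NV : (Fin (d + 1) → ZMod (2 * L)) → (CvX d L mv kk hL × ι → ℝ) →ₗ[ℝ] (CvX d L mv kk hL × ι → ℝ))
          (NV' : (Fin (d + 1) → ZMod (2 * L)) → (CvX' d L mv kk r hL × ι → ℝ) →ₗ[ℝ] (CvX' d L mv kk r hL × ι → ℝ)),
        (∀ k, mmulOp (fun x => coordMat e (ContinuousLinearMap.mulLeftRight ℝ (Matrix mm mm ℂ) (w k x) (w k x)ᴴ)) ∘ₗ P ∘ₗ mmulOp (fun x => (coordMat e (ContinuousLinearMap.mulLeftRight ℝ (Matrix mm mm ℂ) (w k x) (w k x)ᴴ))ᵀ) = (cvNL d L mv kk hL a ι) - NV k) →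
        (∀ k, mmulOp (fun x' => coordMat e (ContinuousLinearMap.mulLeftRight ℝ (Matrix mm mm ℂ) (w' k x') (w' k x')ᴴ)) ∘ₗ P' ∘ₗ mmulOp (fun x' => (coordMat e (ContinuousLinearMap.mulLeftRight ℝ (Matrix mm mm ℂ) (w' k x') (w' k x')ᴴ))ᵀ) = (cvNL' d L mv kk r hL a ι) - NV' k) →
        (∀ k x' i, ∑ j, |(cvChi' d L mv kk r hL k x' • tCoefC ((((L ^ r * L ^ kk : ℕ) : ℝ))⁻¹) (gaugePair (bshiftEquiv (cvM d L mv kk hL) (L ^ r * L ^ kk)) fun μ x' => coordMat e (ContinuousLinearMap.mulLeftRight ℝ (Matrix mm mm ℂ) (w' k x' * (U' μ x' : Matrix mm mm ℂ) * (w' k (bshiftEquiv (cvM d L mv kk hL) (L ^ r * L ^ kk) μ x'))ᴴ) (w' k x' * (U' μ x' : Matrix mm mm ℂ) *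
          (w' k (bshiftEquiv (cvM d L mv kk hL) (L ^ r * L ^ kk) μ x'))ᴴ)ᴴ)) x') i j - (cvChi d L mv kk hL k ((kingPrV L kk r (cvM d L mv kk hL)) x') • tCoefC ((((L ^ kk : ℕ) : ℝ))⁻¹) (gaugePair (bshiftEquiv (cvM d L mv kk hL) (L ^ kk)) fun μ x => coordMat e (ContinuousLinearMap.mulLeftRight ℝ (Matrix mm mm ℂ) (w k x * (U μ x : Matrix mm mm ℂ) *
          (w k (bshiftEquiv (cvM d L mv kk hL) (L ^ kk) μ x))ᴴ) (w k x * (U μ x : Matrix mm mm ℂ) * (w k (bshiftEquiv (cvM d L mv kk hL) (L ^ kk) μ x))ᴴ)ᴴ)) ((kingPrV L kk r (cvM d L mv kk hL)) x')) i j| ≤ oV) →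
        (∀ k j' x' i, ∑ j, |(cvChi' d L mv kk r hL k x' • tCoefA ((((L ^ r * L ^ kk : ℕ) : ℝ))⁻¹) (gaugePair (bshiftEquiv (cvM d L mv kk hL) (L ^ r * L ^ kk)) fun μ x' => coordMat e (ContinuousLinearMap.mulLeftRight ℝ (Matrix mm mm ℂ) (w' k x' * (U' μ x' : Matrix mm mm ℂ) * (w' k (bshiftEquiv (cvM d L mv kk hL) (L ^ r * L ^ kk) μ x'))ᴴ) (w' k x' * U' μ x'
          * (w' k (bshiftEquiv (cvM d L mv kk hL) (L ^ r * L ^ kk) μ x'))ᴴ)ᴴ)) j' x') i j - (cvChi d L mv kk hL k ((kingPrV L kk r (cvM d L mv kk hL)) x') • tCoefA ((((L ^ kk : ℕ) : ℝ))⁻¹) (gaugePair (bshiftEquiv (cvM d L mv kk hL) (L ^ kk)) fun μ x => coordMat e (ContinuousLinearMap.mulLeftRight ℝ (Matrix mm mm ℂ) (w k x * U μ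
          x * (w k (bshiftEquiv (cvM d L mv kk hL) (L ^ kk) μ x))ᴴ) (w k x * (U μ x : Matrix mm mm ℂ) * (w k (bshiftEquiv (cvM d L mv kk hL) (L ^ kk) μ x))ᴴ)ᴴ)) j' ((kingPrV L kk r (cvM d L mv kk hL)) x')) i j| ≤ oV) →
        (∀ k, HasMaj (CvNorm d L mv kk hL ι) (CvNorm d L mv kk hL ι) (mulOp (fun p : CvX d L mv kk hL × ι => cvPsi d L mv kk hL k p.1) ∘ₗ NV k ∘ₗ mulOp (fun p : CvX d L mv kk hL × ι => cvChi d L mv kk hL k p.1)) (fun y y' => RN * Real.exp (-(δ * (unitTorusGeo L kk (cvM d L mv kk hL)).dist y y')))) →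
        (∀ k, HasMaj (BlockNorm.ofBlocks (unitTorusGeo L kk (cvM d L mv kk hL)) (liftBlk (cvBlk d L mv kk hL ∘ (kingPrV L kk r (cvM d L mv kk hL))) ι)) (BlockNorm.ofBlocks (unitTorusGeo L kk (cvM d L mv kk hL)) (liftBlk (cvBlk d L mv kk hL ∘ (kingPrV L kk r (cvM d L mv kk hL))) ι)) (mulOp (fun p : CvX' d L mv kk r hL × ι => cvPsi' d L mv
          kk r hL k p.1) ∘ₗ NV' k ∘ₗ mulOp (fun p : CvX' d L mv kk r hL × ι => cvChi' d L mv kk r hL k p.1)) (fun y y' => RN * Real.exp (-(δ * (unitTorusGeo L kk (cvM d L mv kk hL)).dist y y')))) →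
        (∀ k, HasMaj (CvNorm d L mv kk hL ι) (BlockNorm.ofBlocks (unitTorusGeo L kk (cvM d L mv kk hL)) (liftBlk (cvBlk d L mv kk hL ∘ (kingPrV L kk r (cvM d L mv kk hL))) ι)) (idef (pull (liftMap (kingPrV L kk r (cvM d L mv kk hL)) ι)) (pull (liftMap (kingPrV L kk r (cvM d L mv kk hL)) ι)) (mulOp (fun p : CvX' d L mv kk r hL × ι =>
          cvPsi' d L mv kk r hL k p.1) ∘ₗ NV' k ∘ₗ mulOp (fun p : CvX' d L mv kk r hL × ι => cvChi' d L mv kk r hL k p.1)) (mulOp (fun p : CvX d L mv kk hL × ι => cvPsi d L mv kk hL k p.1) ∘ₗ NV k ∘ₗ mulOp (fun p : CvX d L mv kk hL × ι => cvChi d L mv kk hL k p.1))) (fun y y' => oN * Real.exp (-(δ * (unitTorusGeo L kk (cvM d L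
          mv kk hL)).dist y y')))) →
        (∀ k, HasMaj (CvNorm d L mv kk hL ι) (CvNorm d L mv kk hL ι) ((LinearMap.id - mulOp (fun p : CvX d L mv kk hL × ι => cvPsi d L mv kk hL k p.1)) ∘ₗ NV k ∘ₗ mulOp (fun p : CvX d L mv kk hL × ι => cvChi d L mv kk hL k p.1)) (fun y y' => θF * Real.exp (-(δ * (unitTorusGeo L kk (cvM d L mv kk hL)).dist y y')))) →
        (∀ k, HasMaj (BlockNorm.ofBlocks (unitTorusGeo L kk (cvM d L mv kk hL)) (liftBlk (cvBlk d L mv kk hL ∘ (kingPrV L kk r (cvM d L mv kk hL))) ι)) (BlockNorm.ofBlocks (unitTorusGeo L kk (cvM d L mv kk hL)) (liftBlk (cvBlk d L mv kk hL ∘ (kingPrV L kk r (cvM d L mv kk hL))) ι)) ((LinearMap.id - mulOp (fun p : CvX' d L mv kk r hL × ι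
          => cvPsi' d L mv kk r hL k p.1)) ∘ₗ NV' k ∘ₗ mulOp (fun p : CvX' d L mv kk r hL × ι => cvChi' d L mv kk r hL k p.1)) (fun y y' => θF * Real.exp (-(δ * (unitTorusGeo L kk (cvM d L mv kk hL)).dist y y')))) →
        (∀ k, HasMaj (CvNorm d L mv kk hL ι) (BlockNorm.ofBlocks (unitTorusGeo L kk (cvM d L mv kk hL)) (liftBlk (cvBlk d L mv kk hL ∘ (kingPrV L kk r (cvM d L mv kk hL))) ι)) (idef (pull (liftMap (kingPrV L kk r (cvM d L mv kk hL)) ι)) (pull (liftMap (kingPrV L kk r (cvM d L mv kk hL)) ι)) ((LinearMap.id - mulOp (fun p : CvX' d L mv kk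
          r hL × ι => cvPsi' d L mv kk r hL k p.1)) ∘ₗ NV' k ∘ₗ mulOp (fun p : CvX' d L mv kk r hL × ι => cvChi' d L mv kk r hL k p.1)) ((LinearMap.id - mulOp (fun p : CvX d L mv kk hL × ι => cvPsi d L mv kk hL k p.1)) ∘ₗ NV k ∘ₗ mulOp (fun p : CvX d L mv kk hL × ι => cvChi d L mv kk hL k p.1))) (fun y y' => rD * Real.exp (-(δ *
          (unitTorusGeo L kk (cvM d L mv kk hL)).dist y y')))) →
        (∀ k x' i, ∑ j, |coordMat e (ContinuousLinearMap.mulLeftRight ℝ (Matrix mm mm ℂ) (w' k x') (w' k x')ᴴ) i j - coordMat e (ContinuousLinearMap.mulLeftRight ℝ (Matrix mm mm ℂ) (w k ((kingPrV L kk r (cvM d L mv kk hL)) x')) (w k ((kingPrV L kk r (cvM d L mv kk hL)) x'))ᴴ) i j| ≤ oW) →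
        (∀ k x' i, ∑ j, |(coordMat e (ContinuousLinearMap.mulLeftRight ℝ (Matrix mm mm ℂ) (w' k x') (w' k x')ᴴ))ᵀ i j - (coordMat e (ContinuousLinearMap.mulLeftRight ℝ (Matrix mm mm ℂ) (w k ((kingPrV L kk r (cvM d L mv kk hL)) x')) (w k ((kingPrV L kk r (cvM d L mv kk hL)) x'))ᴴ))ᵀ i j| ≤ oW) →
        HasMaj (CvNorm d L mv kk hL ι) (BlockNorm.ofBlocks (unitTorusGeo L kk (cvM d L mv kk hL)) (liftBlk (cvBlk d L mv kk hL ∘ kingPrV L kk r (cvM d L mv kk hL)) ι)) (idef (pull (liftMap (kingPrV L kk r (cvM d L mv kk hL)) ι)) (pull (liftMap (kingPrV L kk r (cvM d L mv kk hL)) ι))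
            (cvGlued' d L mv kk r hL a ((((L ^ r * L ^ kk : ℕ) : ℝ))⁻¹) ι e w' (fun μ x => (U' μ x : Matrix mm mm ℂ)) P' NV') (cvGlued d L mv kk hL a ((((L ^ kk : ℕ) : ℝ))⁻¹) ι e w (fun μ x => (U μ x : Matrix mm mm ℂ)) P NV)) (fun y y' => D * ((((L ^ kk : ℕ) : ℝ)) ^ (-(1 / 16 : ℝ)) + (o + (oW + rD))) * Real.exp (-(δ / 16 * (unitTorusGeo L kk (cvM d L mv kk hL)).dist y y'))) := by
  obtain ⟨δ, w₀, R₀, θ₀, D, hδ, hR₀, hθ₀, H⟩ := uN_idef_cvGlued_of_reg335Cube (d := d) hL hL7 ha ι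
  refine ⟨δ, w₀, R₀, θ₀, D, hδ, hR₀, hθ₀, fun mv kk r hk hw₀ => ?_⟩
  intro mm _ _ _ e he U U' hU hU' ξ C ξ' C' hξ hC hξ' hC' h335 h335'
  exact H mv kk r hk hw₀ e he U U' hU hU' (fun k => {x : CvX d L mv kk hL | blockOf (L ^ kk) (cvM d L mv kk hL) x.1 ∈ cubeBlocks (cvM d L mv kk hL) (coverCorner (cvM d L mv kk hL) (L ^ mv) L (2 * L ^ mv + 1) k) (6 * L ^ mv + 3)})
    (fun k => {x : CvX' d L mv kk r hL | blockOf (L ^ r * L ^ kk) (cvM d L mv kk hL) x.1 ∈ cubeBlocks (cvM d L mv kk hL) (coverCorner (cvM d L mv kk hL) (L ^ mv) L (2 * L ^ mv + 1) k) (6 * L ^ mv + 3)}) ξ C ξ' C' hξ hC hξ' hC' h335 h335'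
    (fun k x hx => chiCube_cut_ne_zero_nbhd hL hL7 mv kk (L ^ kk) k x hx) (fun k x' hx' => chiCube_cut_ne_zero_nbhd hL hL7 mv kk (L ^ r * L ^ kk) k x' hx')

end BoxTwoGrid

end Summit.QuantumFields.YangMills.BalabanUVNodes.N15.Gluing

end
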